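import Mathlib
import Summits.NavierStokesRegularity.NavierStokesRegularity.Theorems.FilamentSkeletonRssSkeletonJ1RLiaDefectDerivCurvature
import Summits.NavierStokesRegularity.NavierStokesRegularity.Theorems.FilamentSkeletonRssSkeletonJ1RLiaDefectDerivRef

/-!
# Crux `SkeletonJ1R` (stmt-NavierStokesRegularity-23610) · line `streamline_kantorovich_R` · toward stub F2-d (`LiaDefectDerivBL`, v7), first brick of S4′ for B1′:
# THE LIA REFERENCE IS `C³` EVERYWHERE — the third derivative `x‴` in closed form (with the cutoff-derivative term) and its pointwise bound

Hand `leafhand-ns-filamentskeletonrs-1` (gen 0), `--supports stmt-NavierStokesRegularity-23610 --as helper`.  MODEL rung, NEGATIVE side of the ladder: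
calculus for a HYPOTHETICAL filament-type blow-up skeleton; nothing here is a claim about Navier–Stokes regularity; the stub and the crux stay OPEN.

The derivative local-induction estimate S3′ (`…LiaSelfDerivEstimate.symmDerivStrand_sub_lia_le`) needs, on the window `|p − τ| ≤ R` around a collar point,
a derivative `Z` of `x_j″` with bounds.  The landed `…LiaDefectDerivCurvature.IsLiaReference.hasDerivAt_deriv_deriv` gives it only on the closed switched
region `‖x_jτ‖² ≤ 2ℓ²` (where the cutoff `φ` is `1`); window points may leave that region.  Here, GLOBALLY:
* `IsLiaReference.hasDerivAt_deriv_deriv_global` — differentiating the cut-off local-induction ODE `x″ = (β⁻¹φ(x))•x′×W(x)` along the reference: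
  `(x″)′(τ) = (β⁻¹·χ′(1 − (‖xτ‖²/ℓ² − 2))·(−2⟪xτ, x′τ⟫/ℓ²))•x′τ×W(xτ) + (β⁻¹φ(xτ))•(x′τ×DW(xτ)x′τ + x″τ×W(xτ))` (`χ = Real.smoothTransition`,
  `φ = refCutoff ℓ`, `W = ambientField`; chain rule `…LiaDefectDerivSplit.hasDerivAt_switchWeight_comp`);
* `IsLiaReference.norm_thirdDeriv_le` — `‖(x″)′τ‖ ≤ |β⁻¹|·(Cφ·(2‖xτ‖/ℓ²)·‖W(xτ)‖ + ‖DW(xτ)x′τ‖ + ‖x″τ‖‖W(xτ)‖)` with `Cφ = sup|χ′|`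
  (`…LiaDefectDerivRef.abs_deriv_smoothTransition_le`), the input `‖Z‖ ≤ H` of S3′ once `‖W‖, ‖DW‖` are bounded on the window (existing bricks
  `…LiaReference.norm_ambientField_le`, `…LiaLipschitzTools`).
-/

set_option linter.dupNamespace false -- `NavierStokesRegularity.NavierStokesRegularity` path/namespace repetition is the tree convention

noncomputable section

namespace Summit.NavierStokesRegularity.NavierStokesRegularity.Theorems.SkeletonJ1RFrame

open Set Function Filter MeasureTheory Real Topology
open Literature.Analysis.FluidPDE
open Summit.NavierStokesRegularity.NavierStokesRegularity.Theorems.SkeletonJ1RLiaSelf (contDiff_one_deriv)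
open scoped InnerProductSpace BigOperators

variable {N : ℕ} {Γ Rb : ℝ} {p t : Fin N → EuclideanSpace ℝ (Fin 3)} {γ : Fin N → ℝ} {α : ℝ} {s₀ : Fin N → ℝ}
  {x : Fin N → ℝ → EuclideanSpace ℝ (Fin 3)}

/-- **THE THIRD DERIVATIVE OF THE LIA REFERENCE, EVERYWHERE** (cutoff term included). [folklore] -/
theorem IsLiaReference.hasDerivAt_deriv_deriv_global (hx : IsLiaReference Γ Rb p t γ α s₀ x) (ht : ∀ k, ‖t k‖ = 1) (j : Fin N) (τ : ℝ) :
    HasDerivAt (fun τ' => deriv (deriv (x j)) τ')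
      (((liaCoeff Γ γ j)⁻¹ * (deriv Real.smoothTransition (1 - (‖x j τ‖ ^ 2 / (Rb * Real.sqrt (Γ * Real.log Γ)) ^ 2 + 1 - 2 * (3 / 2 : ℝ))) *
            (-(2 * ⟪x j τ, deriv (x j) τ⟫_ℝ / (Rb * Real.sqrt (Γ * Real.log Γ)) ^ 2)))) •
          cross (deriv (x j) τ) (ambientField Γ p t γ α s₀ j (x j τ)) +
        ((liaCoeff Γ γ j)⁻¹ * refCutoff (Rb * Real.sqrt (Γ * Real.log Γ)) (x j τ)) •
          (cross (deriv (x j) τ) (fderiv ℝ (ambientField Γ p t γ α s₀ j) (x j τ) (deriv (x j) τ)) +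
            cross (deriv (deriv (x j)) τ) (ambientField Γ p t γ α s₀ j (x j τ)))) τ := by
  obtain ⟨hC2, hunit, -, -, hode⟩ := hx j
  set ℓ := Rb * Real.sqrt (Γ * Real.log Γ) with hℓdef
  set β := liaCoeff Γ γ j with hβ
  set W := ambientField Γ p t γ α s₀ j with hW
  -- the ODE as a function identity
  have hfun : (fun τ' => deriv (deriv (x j)) τ') = fun τ' => (β⁻¹ * refCutoff ℓ (x j τ')) • cross (deriv (x j) τ') (W (x j τ')) := by
    funext τ'
    have h := hode τ'
    rw [iteratedDeriv_succ, iteratedDeriv_one] at h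
    exact h
  rw [hfun]
  have hp : HasDerivAt (x j) (deriv (x j) τ) τ := ((hC2.differentiable (by norm_num)) τ).hasDerivAt
  have hT : HasDerivAt (fun τ' => deriv (x j) τ') (deriv (deriv (x j)) τ) τ :=
    (((contDiff_one_deriv hC2).differentiable one_ne_zero) τ).hasDerivAt
  have hWd : Differentiable ℝ W := (contDiff_ambientField Γ p t γ α s₀ ht j (n := 1)).differentiable one_ne_zero
  have hWx : HasDerivAt (fun τ' => W (x j τ')) (fderiv ℝ W (x j τ) (deriv (x j) τ)) τ :=
    (hWd (x j τ)).hasFDerivAt.comp_hasDerivAt τ hp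
  have hφ : HasDerivAt (fun τ' => refCutoff ℓ (x j τ'))
      (deriv Real.smoothTransition (1 - (‖x j τ‖ ^ 2 / ℓ ^ 2 + 1 - 2 * (3 / 2 : ℝ))) * (-(2 * ⟪x j τ, deriv (x j) τ⟫_ℝ / ℓ ^ 2))) τ := by
    have h := hasDerivAt_switchWeight_comp (ℓ := ℓ) (s := (3/2:ℝ)) hp
    refine h.congr_of_eventuallyEq (Eventually.of_forall fun τ' => ?_)
    simp only [refCutoff]
  have hg := hφ.const_mul β⁻¹
  have hcr : HasDerivAt (fun τ' => cross (deriv (x j) τ') (W (x j τ')))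
      (cross (deriv (x j) τ) (fderiv ℝ W (x j τ) (deriv (x j) τ)) + cross (deriv (deriv (x j)) τ) (W (x j τ))) τ := by
    have h := crossCLM.hasDerivAt_of_bilinear (fun _ => hT) (fun _ => hWx)
    simpa only [crossCLM_apply] using h
  have h := hg.smul hcr
  refine h.congr_deriv ?_
  rw [add_comm]

/-- **Pointwise bound of the third derivative**: `‖(x″)′τ‖ ≤ |β⁻¹|·(Cφ(2‖xτ‖/ℓ²)‖W‖ + ‖DW·x′‖ + ‖x″τ‖‖W‖)` for any `Cφ ≥ sup|χ′|`. [folklore] -/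
theorem IsLiaReference.norm_thirdDeriv_le (hx : IsLiaReference Γ Rb p t γ α s₀ x) (j : Fin N) (τ : ℝ) {Cφ : ℝ}
    (hCφ : ∀ r : ℝ, |deriv Real.smoothTransition r| ≤ Cφ) (hℓ : Rb * Real.sqrt (Γ * Real.log Γ) ≠ 0) :
    ‖((liaCoeff Γ γ j)⁻¹ * (deriv Real.smoothTransition (1 - (‖x j τ‖ ^ 2 / (Rb * Real.sqrt (Γ * Real.log Γ)) ^ 2 + 1 - 2 * (3 / 2 : ℝ))) *
            (-(2 * ⟪x j τ, deriv (x j) τ⟫_ℝ / (Rb * Real.sqrt (Γ * Real.log Γ)) ^ 2)))) •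
          cross (deriv (x j) τ) (ambientField Γ p t γ α s₀ j (x j τ)) +
        ((liaCoeff Γ γ j)⁻¹ * refCutoff (Rb * Real.sqrt (Γ * Real.log Γ)) (x j τ)) •
          (cross (deriv (x j) τ) (fderiv ℝ (ambientField Γ p t γ α s₀ j) (x j τ) (deriv (x j) τ)) +
            cross (deriv (deriv (x j)) τ) (ambientField Γ p t γ α s₀ j (x j τ)))‖ ≤
      |(liaCoeff Γ γ j)⁻¹| * (Cφ * (2 * ‖x j τ‖ / (Rb * Real.sqrt (Γ * Real.log Γ)) ^ 2) * ‖ambientField Γ p t γ α s₀ j (x j τ)‖ +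
        ‖fderiv ℝ (ambientField Γ p t γ α s₀ j) (x j τ) (deriv (x j) τ)‖ +
        ‖deriv (deriv (x j)) τ‖ * ‖ambientField Γ p t γ α s₀ j (x j τ)‖) := by
  obtain ⟨-, hunit, -, -, -⟩ := hx j
  set ℓ := Rb * Real.sqrt (Γ * Real.log Γ) with hℓdef
  set b := (liaCoeff Γ γ j)⁻¹ with hb
  set W := ambientField Γ p t γ α s₀ j (x j τ) with hW
  set DW := fderiv ℝ (ambientField Γ p t γ α s₀ j) (x j τ) (deriv (x j) τ) with hDW
  set T := deriv (x j) τ with hT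
  set K := deriv (deriv (x j)) τ with hK
  have hT1 : ‖T‖ = 1 := hunit τ
  have hℓ2 : 0 < ℓ ^ 2 := by positivity
  have hCφ0 : 0 ≤ Cφ := (abs_nonneg _).trans (hCφ 0)
  -- cutoff factors
  have hφ01 := refCutoff_mem_Icc ℓ (x j τ)
  have hφabs : |refCutoff ℓ (x j τ)| ≤ 1 := by rw [abs_of_nonneg hφ01.1]; exact hφ01.2
  have hχ' : |deriv Real.smoothTransition (1 - (‖x j τ‖ ^ 2 / ℓ ^ 2 + 1 - 2 * (3 / 2 : ℝ))) * (-(2 * ⟪x j τ, T⟫_ℝ / ℓ ^ 2))| ≤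
      Cφ * (2 * ‖x j τ‖ / ℓ ^ 2) := by
    rw [abs_mul, abs_neg, abs_div, abs_of_pos hℓ2, abs_mul, abs_two]
    have hin : |⟪x j τ, T⟫_ℝ| ≤ ‖x j τ‖ := by
      have := abs_real_inner_le_norm (x j τ) T; rwa [hT1, mul_one] at this
    have h1 : |deriv Real.smoothTransition (1 - (‖x j τ‖ ^ 2 / ℓ ^ 2 + 1 - 2 * (3 / 2 : ℝ)))| ≤ Cφ := hCφ _
    exact mul_le_mul h1 (by gcongr) (by positivity) hCφ0
  -- the two summands
  have h1 : ‖(b * (deriv Real.smoothTransition (1 - (‖x j τ‖ ^ 2 / ℓ ^ 2 + 1 - 2 * (3 / 2 : ℝ))) * (-(2 * ⟪x j τ, T⟫_ℝ / ℓ ^ 2)))) • cross T W‖ ≤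
      |b| * (Cφ * (2 * ‖x j τ‖ / ℓ ^ 2) * ‖W‖) := by
    rw [norm_smul, Real.norm_eq_abs, abs_mul, mul_assoc]
    refine mul_le_mul_of_nonneg_left ?_ (abs_nonneg _)
    have hcr : ‖cross T W‖ ≤ ‖W‖ := by have := norm_cross_le_norm_mul_norm T W; rwa [hT1, one_mul] at this
    exact mul_le_mul hχ' hcr (norm_nonneg _) (by positivity)
  have h2 : ‖(b * refCutoff ℓ (x j τ)) • (cross T DW + cross K W)‖ ≤ |b| * (‖DW‖ + ‖K‖ * ‖W‖) := by
    rw [norm_smul, Real.norm_eq_abs, abs_mul]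
    have hc1 : ‖cross T DW‖ ≤ ‖DW‖ := by have := norm_cross_le_norm_mul_norm T DW; rwa [hT1, one_mul] at this
    have hc2 : ‖cross K W‖ ≤ ‖K‖ * ‖W‖ := norm_cross_le_norm_mul_norm K W
    have hsum : ‖cross T DW + cross K W‖ ≤ ‖DW‖ + ‖K‖ * ‖W‖ := (norm_add_le _ _).trans (add_le_add hc1 hc2)
    calc |b| * |refCutoff ℓ (x j τ)| * ‖cross T DW + cross K W‖ ≤ |b| * 1 * (‖DW‖ + ‖K‖ * ‖W‖) := by gcongr
      _ = |b| * (‖DW‖ + ‖K‖ * ‖W‖) := by ring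
  calc _ ≤ ‖(b * (deriv Real.smoothTransition (1 - (‖x j τ‖ ^ 2 / ℓ ^ 2 + 1 - 2 * (3 / 2 : ℝ))) * (-(2 * ⟪x j τ, T⟫_ℝ / ℓ ^ 2)))) • cross T W‖ +
        ‖(b * refCutoff ℓ (x j τ)) • (cross T DW + cross K W)‖ := norm_add_le _ _
    _ ≤ |b| * (Cφ * (2 * ‖x j τ‖ / ℓ ^ 2) * ‖W‖) + |b| * (‖DW‖ + ‖K‖ * ‖W‖) := add_le_add h1 h2
    _ = |b| * (Cφ * (2 * ‖x j τ‖ / ℓ ^ 2) * ‖W‖ + ‖DW‖ + ‖K‖ * ‖W‖) := by ring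

end Summit.NavierStokesRegularity.NavierStokesRegularity.Theorems.SkeletonJ1RFrame

end
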